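import Summits.AtomisticToContinuum.Crystallization.Theorems.ChartedZeroExcessLayeredLatticeLiouvilleZJ

/-!
# Part ZZC «Isolated zone atoms are never pinned» (lens-2 g79, NODE 79 rider 12 — a RECORD ALERT made checkable; imports ZJ only)

A pin certificate `Pinned τ R base kLo kHi x` (tree ZI) always exhibits a Barlow neighbour of `x` INSIDE the region `R`: the star rule puts a
closed star containing `x.2` into the slice, the rhombus and the two cap rules name pinned — hence `R`-resident — neighbours.  Consequently a
pinning datum `IsPinningDatum τ R P B I` (tree ZJ, the conclusion of (L2-S) `DoorChartPinningP`) forces: every `P`-site whose sheet lies weakly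
between two sheets met by `I` has a Barlow neighbour in `R` (`IsPinningDatum.exists_adj_mem`).  Read at the (L2-S) binders (R, P = cool-zone
coordinates, I = core coordinates): NO ISOLATED ZONE ATOM within `Rp` of `x₀` between core sheets.  The module docstring of the memo (NODE-g79 §18)
records the candidate legal instance violating this (perfect lattice, shell container `K = S ∩ B̄(x₀,12) ∖ B̄(x₀,4)`: the centre is a zone atom at
distance `√17 > 4` from `K`, all twelve neighbours at distance `√10 < 4`), i.e. (L2-S) as typed is refuted by that instance as soon as the instance
is admitted by the (GL) binders.  0 sorry.
-/

namespace Summit.AtomisticToContinuum.Crystallization.Theorems.ChartedZeroExcessLayeredLatticeLiouville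

/-- an in-sheet lattice neighbour is a Barlow neighbour. [formal bookkeeping] -/
theorem barlowAdj_inSheet (τ : ℤ → Bool) (k : ℤ) (q : ℤ × ℤ) (j : Fin 6) : BarlowAdj τ (k, q) (k, q + loDir j) :=
  Or.inl ⟨rfl, j, rfl⟩

/-- … and so is the centre of a star seen from a star point. [formal bookkeeping] -/
theorem barlowAdj_inSheet' (τ : ℤ → Bool) (k : ℤ) (c : ℤ × ℤ) (j : Fin 6) : BarlowAdj τ (k, c + loDir j) (k, c) := by
  refine Or.inl ⟨rfl, j + 3, ?_⟩
  have h := loDir_add_three j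
  rw [add_assoc, h, add_zero]

/-- the lower neighbours of an upper site are Barlow neighbours. [formal bookkeeping] -/
theorem barlowAdj_capAbove (τ : ℤ → Bool) (k : ℤ) (q : ℤ × ℤ) (i : Fin 3) : BarlowAdj τ (k + 1, q) (k, q + triVert (τ k) i) :=
  Or.inr (Or.inr ⟨rfl, i, rfl⟩)

/-- the upper sites capped by a lower site are Barlow neighbours. [formal bookkeeping] -/
theorem barlowAdj_capBelow (τ : ℤ → Bool) (k : ℤ) (q : ℤ × ℤ) (i : Fin 3) : BarlowAdj τ (k, q) (k + 1, q - triVert (τ k) i) :=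
  Or.inr (Or.inl ⟨rfl, i, (sub_add_cancel q _).symm⟩)

/-- ★ a FLAT pin certificate exhibits an in-sheet neighbour inside the region. [this file, g79] -/
theorem PinnedFlat.exists_adj_mem {τ : ℤ → Bool} {R : Set (ℤ × ℤ × ℤ)} {base : ℤ → ℤ × ℤ} {kLo kHi : ℤ}
    (hbase : ∀ k, kLo ≤ k → k ≤ kHi → loStar (base k) ⊆ slice R k) {x : ℤ × ℤ × ℤ} (h : PinnedFlat R base kLo kHi x) :
    ∃ y, BarlowAdj τ x y ∧ y ∈ R := by
  cases h with
  | star k c q hk hc hq =>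
    have hst : loStar c ⊆ slice R k := loStar_subset_of_reach (hbase k hk.1 hk.2) hc
    rcases hq with rfl | ⟨j, rfl⟩
    · exact ⟨(k, q + loDir 0), barlowAdj_inSheet τ k q 0, hst (Or.inr ⟨0, rfl⟩)⟩
    · exact ⟨(k, c), barlowAdj_inSheet' τ k c j, hst (self_mem_loStar c)⟩
  | rhombus k q m hR h₁ h₂ h₃ => exact ⟨(k, q + loDir m), barlowAdj_inSheet τ k q m, h₁.mem hbase⟩

/-- ★★ a pin certificate exhibits a Barlow neighbour inside the region: ISOLATED SITES ARE NEVER PINNED. [this file, g79] -/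
theorem Pinned.exists_adj_mem {τ : ℤ → Bool} {R : Set (ℤ × ℤ × ℤ)} {base : ℤ → ℤ × ℤ} {kLo kHi : ℤ}
    (hbase : ∀ k, kLo ≤ k → k ≤ kHi → loStar (base k) ⊆ slice R k) {x : ℤ × ℤ × ℤ} (h : Pinned τ R base kLo kHi x) :
    ∃ y, BarlowAdj τ x y ∧ y ∈ R := by
  cases h with
  | flat x h => exact h.exists_adj_mem hbase
  | rhombus k q m hR h₁ h₂ h₃ => exact ⟨(k, q + loDir m), barlowAdj_inSheet τ k q m, h₁.mem hbase⟩
  | capAbove k q hk hR h => exact ⟨(k, q + triVert (τ k) 0), barlowAdj_capAbove τ k q 0, (h 0).mem hbase⟩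
  | capBelow k q hk hR h => exact ⟨(k + 1, q - triVert (τ k) 0), barlowAdj_capBelow τ k q 0, (h 0).mem hbase⟩

/-- [formal bookkeeping] -/
theorem not_pinned_of_isolated {τ : ℤ → Bool} {R : Set (ℤ × ℤ × ℤ)} {base : ℤ → ℤ × ℤ} {kLo kHi : ℤ}
    (hbase : ∀ k, kLo ≤ k → k ≤ kHi → loStar (base k) ⊆ slice R k) {x : ℤ × ℤ × ℤ} (hiso : ∀ y, BarlowAdj τ x y → y ∉ R) :
    ¬ Pinned τ R base kLo kHi x := fun h => by
  obtain ⟨y, hy, hyR⟩ := h.exists_adj_mem hbase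
  exact hiso y hy hyR

/-- ★★★ **A PINNING DATUM HAS NO ISOLATED PIN-REGION SITE BETWEEN INNER SHEETS**: if `x ∈ P` lies weakly above the sheet of some inner site and
weakly below the sheet of another, then `x` has a Barlow neighbour in `R`.  At the (L2-S) binders: every cool-zone atom within `Rp` of `x₀` whose
sheet is met on both sides by the core has a zone atom among its twelve neighbours. [this file, g79] -/
theorem IsPinningDatum.exists_adj_mem {τ : ℤ → Bool} {R P B I : Set (ℤ × ℤ × ℤ)} (h : IsPinningDatum τ R P B I) {x : ℤ × ℤ × ℤ} (hx : x ∈ P)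
    (h₁ : ∃ y ∈ I, y.1 ≤ x.1) (h₂ : ∃ z ∈ I, x.1 ≤ z.1) : ∃ y, BarlowAdj τ x y ∧ y ∈ R := by
  obtain ⟨kLo, kHi, base, hI, hbase, hpin, -, -, -⟩ := h
  obtain ⟨y, hy, hyx⟩ := h₁
  obtain ⟨z, hz, hxz⟩ := h₂
  have hlo : kLo ≤ x.1 := by have := (hI y hy).1; omega
  have hhi : x.1 ≤ kHi := by have := (hI z hz).2; omega
  exact (hpin x hx hlo hhi).exists_adj_mem hbase

/-- ★ the same, contrapositive: an ISOLATED `P`-site between inner sheets REFUTES every pinning datum. [this file, g79] -/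
theorem not_isPinningDatum_of_isolated {τ : ℤ → Bool} {R P B I : Set (ℤ × ℤ × ℤ)} {x : ℤ × ℤ × ℤ} (hx : x ∈ P) (h₁ : ∃ y ∈ I, y.1 ≤ x.1)
    (h₂ : ∃ z ∈ I, x.1 ≤ z.1) (hiso : ∀ y, BarlowAdj τ x y → y ∉ R) : ¬ IsPinningDatum τ R P B I := fun h => by
  obtain ⟨y, hy, hyR⟩ := h.exists_adj_mem hx h₁ h₂
  exact hiso y hy hyR

end Summit.AtomisticToContinuum.Crystallization.Theorems.ChartedZeroExcessLayeredLatticeLiouville
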